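import Summits.BirchSwinnertonDyer.Rank1Residual.X11b.BDPRouteOddPrime
import HarnessLib

/-!
# Class X11b, route "BDP + converse-theorem engine + Kolyvagin": RIGIDITY — the typed input STEP L is EXACTLY the main-conjecture half of `BSD(E,p)` (cell `b2b-bsdres`, sub-cell `multr1-p2`, gen 5) — data level

HONEST FRAMING (cell `b2b-bsdres`, run/shared/lean/b2b/bsd-rank1-residual/, verbatim in every
file): the goal of the cell is to DELETE the COMBINATION-SHAPED residual classes of the
Birch–Swinnerton-Dyer formula for ALL analytic-rank `≤ 1` elliptic curves over `ℚ` — "full BSD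
formula for every rank `≤ 1` curve in class `C`" assembled STRICTLY from published theorems — so
that the rank-`≤ 1` remainder becomes exactly the CONSTRUCTION-SHAPED classes, which are TYPED
(missing-input `Prop`s), NOT attempted. This is not "finishing BSD". Sub-cell `multr1-p2` is a
RESEARCH ROUTE on class X11b (`ClassX11b W p := r_an = 1 ∧ p ≠ 2 ∧ mult(p) ∧ irr(p)`,
`Partition/Rows.lean`); no claim beyond the stated class and loci; X11b's label does not change.

THEOREMS ONLY (no definition, no named fact). Gens 1–4 proved `STEP L ⇒ lower half`
(`missingLowerBoundAt_of_indexLowerBoundAt`, `X11b/BDPRouteHalves.lean`) where STEP L is the route's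
ONE typed input `IndexLowerBoundAt W p K P` (`X11b/BDPRoute.lean`; Jetchev–Skinner–Wan 2017
(eq:shalowerK-1) = Castella 2018 (1.1), OPEN at `p ∥ N`) and the lower half is the cell's
`Typed.MissingLowerBoundAt W p` ("`ord_p #Ш(E)_an ≤ ord_p #Ш(E)`"). This file proves the CONVERSE
on the same data, so that on the route's Heegner data the typed input and the missing conclusion are
EQUIVALENT given the published facts:

* `indexLowerBoundAt_of_missingLowerBoundAt` — data level: the lower half of `BSD(E,p)` + the
  `≥`-half of the rank-`0` `p`-part for the twist (Skinner 2016 Thm. C at `p ∥ N`) + the Tamagawa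
  transport `ord_p ∏c(E^{d_K}) = ord_p ∏c(E)` ⇒ STEP L at the datum. Arithmetic (the Gross–Zagier
  bookkeeping identity `exists_shaAn_padicVal_eq_of_heegner`, EXACT at odd `p`):
  `2v(I) = v(q) + v(q_d) + v(c_W) + 2v(t_d) ≤ v(Ш_W) + [v(Ш_d) + v(c_d) − 2v(t_d)] + v(c_W) + 2v(t_d)
  = v(Ш_K) + 2v(c_W)`.
* `indexLowerBoundAt_iff_missingLowerBoundAt_of_tamagawaTransport`, `…_of_heegnerData` (`p ≥ 5`, ANY
  Heegner field, transport (d) = `padicValNat_tamagawaProduct_twist_of_heegner`),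
  `…_of_heegnerData_of_odd` (every odd `p`, `d_K` odd — transport (d) = eisenstein-p2's
  `X2.padicValNat_tamagawaProduct_twist_of_heegner_of_odd`): **STEP L at the datum ⟺
  `Typed.MissingLowerBoundAt W p`.**
* `bsdp_of_indexLowerBoundAt_of_heegnerData_of_odd` — ONE datum suffices: on X11b ∧ (ram) ∧
  `p ∤ ∏c_ℓ`, STEP L at a single Manin-good Heegner datum with `d_K` odd gives `BSD(E,p)` (both halves
  at that datum: Kolyvagin 1990 Thm. A + Skinner 2016 Thm. C); and then STEP L holds at EVERY such
  datum (`indexLowerBoundAt_of_bsdp_of_heegnerData_of_odd`).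

READING (numbers, not adjectives). The route has reduced NOTHING of the main-conjecture half: its typed
input is, pair by pair and datum by datum, exactly as strong as the missing conclusion
`ord_p #Ш(E)_an ≤ ord_p #Ш(E)`; any source of that half (erratum Thm. A′ ⇐ Fouquet–Wan 4.41 on its
shape; Skinner–Zhang 2014 Thm. 1.2 on its shape; a per-pair certificate) discharges STEP L on its
pairs, and conversely no proof of STEP L at `p ∥ N` can avoid proving the lower half of `BSD(E,p)`.
What the route DID deliver is the other half unconditionally on `Locus` and the exact Tamagawa defect
(gens 3–4). Class-level form of the equivalence: `X11b/BDPRouteRigidityClass.lean`.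

NOTE on the parity of `d_K` (correction of a prose remark in HOME REPORT §10.1, gen 4: "2 may ramify
in `K`, where `c_2(E^{d_K}) = 3` is possible" — it is NOT): for a Heegner field `K` of `E` and a prime
`ℓ ∣ d_K` (so `ℓ ∤ N`, `E` good at `ℓ`, `E^{d_K}` additive at `ℓ`), the Néron component group satisfies
`Φ_ℓ(E^{d_K})(k̄)[p^∞] ≅ E^{d_K}[p^∞]^{I_ℓ} = (E[p^∞] ⊗ χ_{d_K})^{I_ℓ} = 0` for every odd `p`
(inertia acts through `χ_{d_K}(I_ℓ) = {±1}`), INCLUDING `ℓ = 2`; so `p ∤ c_ℓ(E^{d_K})` and transport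
(d) holds for every Heegner field at every odd `p` (numerical check: job j086115/j086177, 18 000 twists
`E^d`, `2 ∣ d`, of 600 curves good at `2`: no `c_2 ≡ 0 (mod 3)`). The tree proves transport (d) by
Tate's algorithm, at odd `ℓ ∣ d_K` only (Kodaira `I₀*`), which is why the odd-`p` theorems here and in
`BDPRouteOddPrime*.lean` carry `Odd d_K`; the gen-4 hypothesis `hL` quantified over ALL Heegner fields
is therefore (by the component-group argument, not in the tree) still equivalent to the lower half,
and the `Odd d_K` forms below are the ones whose equivalence is a KERNEL theorem.

References: [JetchevSkinnerWan2017] §7.4.1–7.4.2 (pp. 30–31 of arXiv:1512.06894), (eq:tamK);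
[Castella2018] (1.1), (5.2)–(5.3); [Skinner2016PacificMC] Thm. C, footnote 1; [GrossZagier1986]
V.§2; [McCallumLMS1991] §1; [Miller2011LMS] Def. 1.1; [SilvermanAEC] VII.6.1 / [Silverman1994]
IV.9.2 (component groups and inertia).
-/

noncomputable section

open scoped Classical

open WeierstrassCurve NumberField Literature.NumberTheory.EllipticCurves
  Literature.NumberTheory.EllipticCurves.ModularForms
  Literature.NumberTheory.EllipticCurves.Rank1Residual
  Literature.NumberTheory.EllipticCurves.KrizLi2019

namespace Summit.BirchSwinnertonDyer.Rank1Residual.X11b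

/-! ### Data level: the lower half of `BSD(E,p)` gives STEP L back -/

/-- **The converse of `missingLowerBoundAt_of_indexLowerBoundAt`: the main-conjecture half of
`BSD(E,p)` implies STEP L at the datum.** Data as in `exists_shaAn_padicVal_eq_of_heegner` (`W/ℚ`
globally minimal, `ord_{s=1} L(E,s) = 1`; `K` imaginary quadratic with the Heegner hypothesis for the
level `N` and `L(E^{d_K},1) ≠ 0`; `P` the Heegner point of a datum with `p ∤ c`; `p` odd,
`p ∤ #𝓞_K^×`; `Wd = Cd • W^{(d_K)}` globally minimal with `ord_p u(Cd) = 0` and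
`ord_p ∏c_ℓ(Wd) = ord_p ∏c_ℓ(W)`); PUBLISHED binders `hGZ`, `hKo`, `hGZK`, `hmod`; the `≥`-HALF of the
rank-`0` `p`-part for the twist (`htw`: `ord_p (L(E^D,1)/Ω_{E^D}) ≤ ord_p #Ш(E^D) + ord_p ∏c_ℓ(E^D) −
2·ord_p #E^D(ℚ)_tors`, supplied at `p ∥ N` by Skinner 2016 Thm. C); and the lower half
`hlow : Typed.MissingLowerBoundAt W p`. CONCLUSION: `IndexLowerBoundAt W p K P`
(`2·ord_p [E(K):ℤP] ≤ ord_p #Ш(E/K) + 2·ord_p ∏_ℓ c_ℓ(E)`). Arithmetic: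
`2v(I) = v(q) + v(q_d) + v(c_W) + 2v(t_d) ≤ v(Ш_W) + v(Ш_d) + v(c_d) + v(c_W) = v(Ш_K) + 2v(c_W)`.
Bookkeeping on published facts; nothing open is used. [cite: JetchevSkinnerWan2017, §7.4.1 (eq:gz for K′), (eq:tamK), pp. 29–30]
[cite: Miller2011LMS, Def. 1.1] -/
theorem indexLowerBoundAt_of_missingLowerBoundAt
    (W : WeierstrassCurve ℚ) [W.IsElliptic] [W.IsGloballyMinimal] (p : ℕ) [Fact p.Prime]
    (N : ℕ) [NeZero N] (K : Type) [Field K] [NumberField K]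
    (Dt : ModularParametrizationData W N) (H : HeegnerDatum N (NumberField.discr K)) (ι : K →+* ℂ)
    (P : (W.baseChange K).toAffine.Point)
    -- the published inputs (named facts of the tree)
    (hGZ : gross_zagier N W K) (hKo : kolyvagin N W K)
    (hGZK : rank_eq_analyticRank_of_analyticRank_le_one) (hmod : hasEntireLFunction_rat)
    -- the data
    (hK : IsImaginaryQuadratic K) (hHN : SatisfiesHeegnerHypothesis N K)
    (hP : WeierstrassCurve.Affine.Point.map ι.toRatAlgHom P = heegnerPointComplex Dt H)
    (hp2 : p ≠ 2) (hc : ¬ (p : ℤ) ∣ Dt.c) (hμ : ¬ p ∣ Units.torsionOrder K)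
    (hr : W.analyticRank = 1)
    (hLt : (W.quadraticTwist (NumberField.discr K : ℚ)).entireLFunction 1 ≠ 0)
    -- a globally minimal model of the quadratic twist by `d_K`
    (Wd : WeierstrassCurve ℚ) [Wd.IsElliptic] [Wd.IsGloballyMinimal] (Cd : VariableChange ℚ)
    (hWd : Cd • W.quadraticTwist (NumberField.discr K : ℚ) = Wd)
    (hu : padicValRat p (Cd.u : ℚ) = 0)
    (htam : padicValNat p Wd.tamagawaProduct = padicValNat p W.tamagawaProduct)
    -- the `≥`-half of the rank-zero `p`-part for the twist
    (htw : ∃ q : ℚ, Wd.entireLFunction 1 / (Wd.realPeriodRat : ℂ) = (q : ℂ) ∧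
      padicValRat p q ≤ (padicValNat p Wd.shaOrder : ℤ) + padicValNat p Wd.tamagawaProduct -
        2 * padicValNat p Wd.torsionOrder)
    -- the lower half of `BSD(E,p)`
    (hlow : Typed.MissingLowerBoundAt W p) :
    IndexLowerBoundAt W p K P := by
  obtain ⟨qd, hqd, hvqd⟩ := htw
  obtain ⟨-, -, hsha, q, hq, hval⟩ := exists_shaAn_padicVal_eq_of_heegner W p N K Dt H ι P
    hGZ hKo hGZK hmod hK hHN hP hp2 hc hμ hr hLt Wd Cd hWd hu qd hqd
  obtain ⟨q', hq', hle⟩ := hlow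
  have hqq : q' = q := by exact_mod_cast hq'.symm.trans hq
  rw [hqq] at hle
  unfold IndexLowerBoundAt
  have e2 : (padicValNat p (W.baseChange K).shaOrder : ℤ) =
      padicValNat p W.shaOrder + padicValNat p Wd.shaOrder := by exact_mod_cast hsha
  have e3 : (padicValNat p Wd.tamagawaProduct : ℤ) = padicValNat p W.tamagawaProduct := by
    exact_mod_cast htam
  have e1 : (2 * padicValNat p (AddSubgroup.zmultiples P).index : ℤ) ≤
      padicValNat p (W.baseChange K).shaOrder + 2 * padicValNat p W.tamagawaProduct := by
    omega
  exact_mod_cast e1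

/-- **STEP L at the datum ⟺ the lower half of `BSD(E,p)`, given the Tamagawa transport as a
hypothesis** (`htam : ord_p ∏c_ℓ(Wd) = ord_p ∏c_ℓ(W)`; both specialisations below supply it from tree
theorems). Data: `W/ℚ` globally minimal of conductor `N`, `ord_{s=1} L(E,s) = 1`, `p` odd multiplicative
with `E[p]` irreducible and a (ram) prime (so that Skinner 2016 Thm. C — `hSk`, `p ≥ 3`, BOTH halves of
the twist's rank-`0` `p`-part — applies to the minimal twist model, transports (a),(b),(c),(e) from
`TwistTransport*.lean`); `K` imaginary quadratic, Heegner hypothesis for `N`, `p ∤ #𝓞_K^×`,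
`L(E^{d_K},1) ≠ 0`; `P` the Heegner point of a datum with `p ∤ c`. PUBLISHED binders `hGZ`, `hKo`,
`hSk`, `hGZK`, `hmod`. Bookkeeping. [cite: JetchevSkinnerWan2017, §7.4.1 (pp. 30–31) and (eq:tamK)]
[cite: Skinner2016PacificMC, Thm. C (§1) and footnote 1] [cite: Miller2011LMS, Def. 1.1] -/
theorem indexLowerBoundAt_iff_missingLowerBoundAt_of_tamagawaTransport
    (W : WeierstrassCurve ℚ) [W.IsElliptic] [W.IsGloballyMinimal] (p : ℕ) [Fact p.Prime]
    [NeZero (W.conductorNorm ℤ)] (K : Type) [Field K] [NumberField K]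
    (Dt : ModularParametrizationData W (W.conductorNorm ℤ))
    (H : HeegnerDatum (W.conductorNorm ℤ) (NumberField.discr K)) (ι : K →+* ℂ)
    (P : (W.baseChange K).toAffine.Point)
    -- the published inputs (named facts of the tree)
    (hGZ : gross_zagier (W.conductorNorm ℤ) W K) (hKo : kolyvagin (W.conductorNorm ℤ) W K)
    (hSk : Skinner2016.thmC_padicValRat_bsd_rank_zero)
    (hGZK : rank_eq_analyticRank_of_analyticRank_le_one) (hmod : hasEntireLFunction_rat)
    -- the pair
    (hr : W.analyticRank = 1) (hp2 : p ≠ 2) (hmult : Mult W p) (hirr : Irr W p) (hram : Ram W p)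
    -- the Heegner data
    (hK : IsImaginaryQuadratic K) (hHN : SatisfiesHeegnerHypothesis (W.conductorNorm ℤ) K)
    (hP : WeierstrassCurve.Affine.Point.map ι.toRatAlgHom P = heegnerPointComplex Dt H)
    (hc : ¬ (p : ℤ) ∣ Dt.c) (hμ : ¬ p ∣ Units.torsionOrder K)
    (hLt : (W.quadraticTwist (NumberField.discr K : ℚ)).entireLFunction 1 ≠ 0)
    (Wd : WeierstrassCurve ℚ) [Wd.IsElliptic] [Wd.IsGloballyMinimal] (Cd : VariableChange ℚ)
    (hWd : Cd • W.quadraticTwist (NumberField.discr K : ℚ) = Wd)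
    (htam : padicValNat p Wd.tamagawaProduct = padicValNat p W.tamagawaProduct) :
    IndexLowerBoundAt W p K P ↔ Typed.MissingLowerBoundAt W p := by
  have hp : p.Prime := Fact.out
  have hp3 : 3 ≤ p := by have := hp.two_le; omega
  have hD0 : (NumberField.discr K : ℚ) ≠ 0 := by exact_mod_cast NumberField.discr_ne_zero K
  haveI hEt : (W.quadraticTwist (NumberField.discr K : ℚ)).IsElliptic :=
    W.isElliptic_quadraticTwist hD0
  -- transports (a), (b), (c), (e) to the minimal twist model (any Heegner field)
  have hmultd : Wd.HasMultiplicativeReductionAtPrime p :=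
    hasMultiplicativeReductionAtPrime_twist_of_heegner' W p K hK hHN hmult Cd hWd
  have hirrd : Wd.HasIrreducibleModPGaloisRep p :=
    hasIrreducibleModPGaloisRep_twist_model W p K hK.1 hirr Cd hWd
  have hramd : Ram Wd p := ram_twist_of_heegner W p K hK hHN hram Cd hWd
  have hu : padicValRat p (Cd.u : ℚ) = 0 :=
    padicValRat_u_eq_zero_of_twist_minimal W p K hK hHN hmult Cd hWd
  -- the twist: `L(E^D,1) ≠ 0`, finiteness, and Skinner's Thm. C (both halves; `p ≥ 3`)
  have hLt' : (W.quadraticTwist (NumberField.discr K : ℚ)).entireLFunction = Wd.entireLFunction := by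
    rw [← hWd, entireLFunction_smul]
  have hLd1 : Wd.entireLFunction 1 ≠ 0 := by rw [← hLt']; exact hLt
  have hrd : Wd.analyticRank = 0 := (Wd.analyticRank_eq_zero_iff_holds (hmod Wd)).2 hLd1
  have hfinSd : Finite Wd.sha := (hGZK Wd (by omega)).2
  obtain ⟨qd, hqd, hvqd⟩ := hSk Wd p hp3 (Or.inr hmultd) hirrd hramd hLd1 hfinSd
  constructor
  · intro hL
    exact missingLowerBoundAt_of_indexLowerBoundAt W p (W.conductorNorm ℤ) K Dt H ι P hGZ hKo hGZK
      hmod hK hHN hP hp2 hc hμ hr hLt Wd Cd hWd hu htam ⟨qd, hqd, hvqd.symm.le⟩ (fun _ ↦ hL)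
  · intro hlow
    exact indexLowerBoundAt_of_missingLowerBoundAt W p (W.conductorNorm ℤ) K Dt H ι P hGZ hKo hGZK
      hmod hK hHN hP hp2 hc hμ hr hLt Wd Cd hWd hu htam ⟨qd, hqd, hvqd.le⟩ hlow

/-- **STEP L at the datum ⟺ the lower half of `BSD(E,p)` — `p ≥ 5`, ANY Heegner field** (transport
(d) for every imaginary quadratic `K` in which all `ℓ ∣ N` split and every `p ≥ 5`:
`padicValNat_tamagawaProduct_twist_of_heegner`, `X11b/TwistTransportTam.lean`). So the typed input of
gens 1–3 (`hL` at every Heegner datum of X11b ∧ `p ≥ 5` ∧ (ram) pairs) is, datum by datum, exactly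
the main-conjecture half of `BSD(E,p)`. Bookkeeping. [cite: JetchevSkinnerWan2017, §7.4.1 (pp. 30–31) and (eq:tamK)]
[cite: Skinner2016PacificMC, Thm. C (§1)] [cite: Miller2011LMS, Def. 1.1] -/
theorem indexLowerBoundAt_iff_missingLowerBoundAt_of_heegnerData
    (W : WeierstrassCurve ℚ) [W.IsElliptic] [W.IsGloballyMinimal] (p : ℕ) [Fact p.Prime]
    [NeZero (W.conductorNorm ℤ)] (K : Type) [Field K] [NumberField K]
    (Dt : ModularParametrizationData W (W.conductorNorm ℤ))
    (H : HeegnerDatum (W.conductorNorm ℤ) (NumberField.discr K)) (ι : K →+* ℂ)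
    (P : (W.baseChange K).toAffine.Point)
    -- the published inputs (named facts of the tree)
    (hGZ : gross_zagier (W.conductorNorm ℤ) W K) (hKo : kolyvagin (W.conductorNorm ℤ) W K)
    (hSk : Skinner2016.thmC_padicValRat_bsd_rank_zero)
    (hGZK : rank_eq_analyticRank_of_analyticRank_le_one) (hmod : hasEntireLFunction_rat)
    -- the pair
    (hr : W.analyticRank = 1) (hp5 : 5 ≤ p) (hmult : Mult W p) (hirr : Irr W p) (hram : Ram W p)
    -- the Heegner data
    (hK : IsImaginaryQuadratic K) (hHN : SatisfiesHeegnerHypothesis (W.conductorNorm ℤ) K)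
    (hP : WeierstrassCurve.Affine.Point.map ι.toRatAlgHom P = heegnerPointComplex Dt H)
    (hc : ¬ (p : ℤ) ∣ Dt.c) (hμ : ¬ p ∣ Units.torsionOrder K)
    (hLt : (W.quadraticTwist (NumberField.discr K : ℚ)).entireLFunction 1 ≠ 0)
    (Wd : WeierstrassCurve ℚ) [Wd.IsElliptic] [Wd.IsGloballyMinimal] (Cd : VariableChange ℚ)
    (hWd : Cd • W.quadraticTwist (NumberField.discr K : ℚ) = Wd) :
    IndexLowerBoundAt W p K P ↔ Typed.MissingLowerBoundAt W p :=
  indexLowerBoundAt_iff_missingLowerBoundAt_of_tamagawaTransport W p K Dt H ι P hGZ hKo hSk hGZK hmod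
    hr (by omega) hmult hirr hram hK hHN hP hc hμ hLt Wd Cd hWd
    (padicValNat_tamagawaProduct_twist_of_heegner W p hp5 K hK hHN Cd hWd)

/-- **STEP L at the datum ⟺ the lower half of `BSD(E,p)` — every ODD prime, `d_K` odd** (transport
(d) at odd `p` for `d_K` odd, `p ∤ d_K`: eisenstein-p2's `X2.padicValNat_tamagawaProduct_twist_of_heegner_of_odd`;
`p ∤ d_K` is automatic: `p ∣ N` splits in `K`). These are exactly the Heegner data the odd-prime
assembly uses (`exists_oddHeegnerData`: Hoffstein–Luo field, `d_K ≡ 1 (mod 8)`). Bookkeeping.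
[cite: JetchevSkinnerWan2017, §7.4.1 (pp. 30–31) and (eq:tamK)]
[cite: Skinner2016PacificMC, Thm. C (§1) and footnote 1] [cite: Miller2011LMS, Def. 1.1] -/
theorem indexLowerBoundAt_iff_missingLowerBoundAt_of_heegnerData_of_odd
    (W : WeierstrassCurve ℚ) [W.IsElliptic] [W.IsGloballyMinimal] (p : ℕ) [Fact p.Prime]
    [NeZero (W.conductorNorm ℤ)] (K : Type) [Field K] [NumberField K]
    (Dt : ModularParametrizationData W (W.conductorNorm ℤ))
    (H : HeegnerDatum (W.conductorNorm ℤ) (NumberField.discr K)) (ι : K →+* ℂ)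
    (P : (W.baseChange K).toAffine.Point)
    -- the published inputs (named facts of the tree)
    (hGZ : gross_zagier (W.conductorNorm ℤ) W K) (hKo : kolyvagin (W.conductorNorm ℤ) W K)
    (hSk : Skinner2016.thmC_padicValRat_bsd_rank_zero)
    (hGZK : rank_eq_analyticRank_of_analyticRank_le_one) (hmod : hasEntireLFunction_rat)
    -- the pair
    (hr : W.analyticRank = 1) (hp2 : p ≠ 2) (hmult : Mult W p) (hirr : Irr W p) (hram : Ram W p)
    -- the Heegner data (`d_K` odd)
    (hK : IsImaginaryQuadratic K) (hodd : Odd (NumberField.discr K))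
    (hHN : SatisfiesHeegnerHypothesis (W.conductorNorm ℤ) K)
    (hP : WeierstrassCurve.Affine.Point.map ι.toRatAlgHom P = heegnerPointComplex Dt H)
    (hc : ¬ (p : ℤ) ∣ Dt.c) (hμ : ¬ p ∣ Units.torsionOrder K)
    (hLt : (W.quadraticTwist (NumberField.discr K : ℚ)).entireLFunction 1 ≠ 0)
    (Wd : WeierstrassCurve ℚ) [Wd.IsElliptic] [Wd.IsGloballyMinimal] (Cd : VariableChange ℚ)
    (hWd : Cd • W.quadraticTwist (NumberField.discr K : ℚ) = Wd) :
    IndexLowerBoundAt W p K P ↔ Typed.MissingLowerBoundAt W p := by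
  have hp : p.Prime := Fact.out
  -- `p ∣ N` (multiplicative at `p`) splits in `K`, so `p ∤ d_K`
  have hpN : p ∣ W.conductorNorm ℤ :=
    (W.dvd_conductorNorm_iff_not_hasGoodReductionAtPrime p).mpr
      (WeierstrassCurve.HasMultiplicativeReduction.not_hasGoodReduction (R := ℤ_[p]) hmult)
  have hpd : ¬ (p : ℤ) ∣ NumberField.discr K :=
    Literature.SatisfiesHeegnerHypothesis.not_dvd_discr hK.1 hHN hp hpN
  exact indexLowerBoundAt_iff_missingLowerBoundAt_of_tamagawaTransport W p K Dt H ι P hGZ hKo hSk hGZK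
    hmod hr hp2 hmult hirr hram hK hHN hP hc hμ hLt Wd Cd hWd
    (X2.padicValNat_tamagawaProduct_twist_of_heegner_of_odd W p hp2 K hK hodd hpd hHN Cd hWd)

/-! ### One datum suffices -/

/-- **`BSD(E,p)` from STEP L at ONE Heegner datum — every odd prime.** For `(E,p)` in X11b with a
(ram) prime and `p ∤ ∏_ℓ c_ℓ(E)`, and ONE Heegner datum of the odd-prime assembly (`K` imaginary
quadratic, `d_K` odd, Heegner hypothesis for `N`, `p ∤ #𝓞_K^×`, `L(E^{d_K},1) ≠ 0`, a parametrisation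
datum with `p ∤ c` and its Heegner point `P`, a minimal twist model): STEP L at THAT datum gives
`BSD(E,p)` — BOTH halves at the same datum (`halves_of_heegnerData_of_odd`: lower half from STEP L,
upper half from Kolyvagin 1990 Thm. A at `K` — `hB`, `ρ̄_{E,p}` onto by `surj_of_irr_of_ram` — and
Skinner 2016 Thm. C for the twist). SEVEN published named facts (`hGZ hKo hB hSk hGZK hmod`); the
odd-`p` analogue at a fixed datum of gen 1's `bsdp_of_classX11b_of_indexLowerBoundAt` (`p ≥ 5`).
CONDITIONAL on STEP L at the datum; nothing booked.
[cite: JetchevSkinnerWan2017, §7.4.1–7.4.3 (pp. 30–31)] [cite: McCallumLMS1991, §1 Theorem (Kolyvagin), p. 296]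
[cite: Skinner2016PacificMC, Thm. C (§1) and footnote 1] [cite: Miller2011LMS, Def. 1.1] -/
theorem bsdp_of_indexLowerBoundAt_of_heegnerData_of_odd
    (W : WeierstrassCurve ℚ) [W.IsElliptic] [W.IsGloballyMinimal] (p : ℕ) [Fact p.Prime]
    [NeZero (W.conductorNorm ℤ)] (K : Type) [Field K] [NumberField K]
    (Dt : ModularParametrizationData W (W.conductorNorm ℤ))
    (H : HeegnerDatum (W.conductorNorm ℤ) (NumberField.discr K)) (ι : K →+* ℂ)
    (P : (W.baseChange K).toAffine.Point)
    -- the published inputs (named facts of the tree)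
    (hGZ : gross_zagier (W.conductorNorm ℤ) W K) (hKo : kolyvagin (W.conductorNorm ℤ) W K)
    (hB : Kolyvagin1990_padicValNat_card_sha_le (W.conductorNorm ℤ) W K)
    (hSk : Skinner2016.thmC_padicValRat_bsd_rank_zero)
    (hGZK : rank_eq_analyticRank_of_analyticRank_le_one) (hmod : hasEntireLFunction_rat)
    -- the pair
    (hX : ClassX11b W p) (hram : Ram W p) (htam0 : ¬ p ∣ W.tamagawaProduct)
    -- ONE Heegner datum with `d_K` odd
    (hK : IsImaginaryQuadratic K) (hodd : Odd (NumberField.discr K))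
    (hHN : SatisfiesHeegnerHypothesis (W.conductorNorm ℤ) K)
    (hP : WeierstrassCurve.Affine.Point.map ι.toRatAlgHom P = heegnerPointComplex Dt H)
    (hc : ¬ (p : ℤ) ∣ Dt.c) (hμ : ¬ p ∣ Units.torsionOrder K)
    (hLt : (W.quadraticTwist (NumberField.discr K : ℚ)).entireLFunction 1 ≠ 0)
    (Wd : WeierstrassCurve ℚ) [Wd.IsElliptic] [Wd.IsGloballyMinimal] (Cd : VariableChange ℚ)
    (hWd : Cd • W.quadraticTwist (NumberField.discr K : ℚ) = Wd)
    -- STEP L at this datum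
    (hL : IndexLowerBoundAt W p K P) : BSDp W p := by
  have hp : p.Prime := Fact.out
  obtain ⟨hr, hp2, hmult, hirr⟩ := hX
  -- `p ∣ N` splits in `K`, so `p ∤ d_K`
  have hpN : p ∣ W.conductorNorm ℤ :=
    (W.dvd_conductorNorm_iff_not_hasGoodReductionAtPrime p).mpr
      (WeierstrassCurve.HasMultiplicativeReduction.not_hasGoodReduction (R := ℤ_[p]) hmult)
  have hpd : ¬ (p : ℤ) ∣ NumberField.discr K :=
    Literature.SatisfiesHeegnerHypothesis.not_dvd_discr hK.1 hHN hp hpN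
  have hsurj : Surj W p := surj_of_irr_of_ram W p hirr hram
  obtain ⟨h1, h2⟩ := halves_of_heegnerData_of_odd W p K Dt H ι P hGZ hKo hSk hGZK hmod hr hp2 hmult
    hirr hram hK hodd hpd hHN hP hc hμ hLt Wd Cd hWd
  exact bsdp_of_halves hGZK W p (le_of_eq hr) (h1 hL)
    (h2 htam0 (fun _ hnt ↦ hB hK hHN ⟨Dt, H, ι, hP⟩ hnt hp hp2 hsurj))

/-- **… and then STEP L holds at EVERY such datum**: `BSD(E,p)` (for instance from STEP L at one
datum, `bsdp_of_indexLowerBoundAt_of_heegnerData_of_odd`) gives back STEP L at every Heegner datum of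
the odd-prime assembly (`Typed.missingPPartAt_of_bsdp`, `Typed.lower_and_upper_of_missingPPartAt`,
`indexLowerBoundAt_iff_missingLowerBoundAt_of_heegnerData_of_odd`). Bookkeeping on published facts.
[cite: Miller2011LMS, Def. 1.1] [cite: JetchevSkinnerWan2017, §7.4.1 (pp. 30–31)] -/
theorem indexLowerBoundAt_of_bsdp_of_heegnerData_of_odd
    (W : WeierstrassCurve ℚ) [W.IsElliptic] [W.IsGloballyMinimal] (p : ℕ) [Fact p.Prime]
    [NeZero (W.conductorNorm ℤ)] (K : Type) [Field K] [NumberField K]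
    (Dt : ModularParametrizationData W (W.conductorNorm ℤ))
    (H : HeegnerDatum (W.conductorNorm ℤ) (NumberField.discr K)) (ι : K →+* ℂ)
    (P : (W.baseChange K).toAffine.Point)
    -- the published inputs (named facts of the tree)
    (hGZ : gross_zagier (W.conductorNorm ℤ) W K) (hKo : kolyvagin (W.conductorNorm ℤ) W K)
    (hSk : Skinner2016.thmC_padicValRat_bsd_rank_zero)
    (hGZK : rank_eq_analyticRank_of_analyticRank_le_one) (hmod : hasEntireLFunction_rat)
    -- the pair
    (hX : ClassX11b W p) (hram : Ram W p)
    -- the Heegner data (`d_K` odd)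
    (hK : IsImaginaryQuadratic K) (hodd : Odd (NumberField.discr K))
    (hHN : SatisfiesHeegnerHypothesis (W.conductorNorm ℤ) K)
    (hP : WeierstrassCurve.Affine.Point.map ι.toRatAlgHom P = heegnerPointComplex Dt H)
    (hc : ¬ (p : ℤ) ∣ Dt.c) (hμ : ¬ p ∣ Units.torsionOrder K)
    (hLt : (W.quadraticTwist (NumberField.discr K : ℚ)).entireLFunction 1 ≠ 0)
    (Wd : WeierstrassCurve ℚ) [Wd.IsElliptic] [Wd.IsGloballyMinimal] (Cd : VariableChange ℚ)
    (hWd : Cd • W.quadraticTwist (NumberField.discr K : ℚ) = Wd)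
    (hbsd : BSDp W p) : IndexLowerBoundAt W p K P := by
  obtain ⟨hr, hp2, hmult, hirr⟩ := hX
  haveI : Finite W.sha := (hGZK W (le_of_eq hr)).2
  have hlow : Typed.MissingLowerBoundAt W p :=
    (Typed.lower_and_upper_of_missingPPartAt W p (Typed.missingPPartAt_of_bsdp W p hbsd)).1
  exact (indexLowerBoundAt_iff_missingLowerBoundAt_of_heegnerData_of_odd W p K Dt H ι P hGZ hKo hSk
    hGZK hmod hr hp2 hmult hirr hram hK hodd hHN hP hc hμ hLt Wd Cd hWd).2 hlow

end Summit.BirchSwinnertonDyer.Rank1Residual.X11b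

end
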